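import Mathlib
import Literature.NumberTheory.LFunctions.Zhang2022.TypedSection14
import Literature.NumberTheory.Sieve.MontgomeryVaughan1975GaussSums
import Literature.NumberTheory.Sieve.MontgomeryVaughan1975Section6C
import Literature.NumberTheory.LFunctions.PrimitiveQuadraticCharacterGaussSum
import Literature.NumberTheory.LFunctions.DirichletCharacterCRT
import Literature.NumberTheory.GaussSums.AdditiveCharacterExpansion
import HarnessLib

/-!
# Zhang (2022) §14: the Gauss-sum and character-orthogonality leaves of the proof of
# Proposition 14.1 — `Z22:§14.u005`, `Z22:§14.u014`, the prose facts of pp. 77–79 DISCHARGED,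
# and the edge u006 + u008 ⇒ (14.4)

Topic `Literature/NumberTheory/LFunctions/Zhang2022` (Landau–Siegel audit tree; verdict-neutral).
Y. Zhang, *Discrete mean estimates and the Landau–Siegel zero*, arXiv:2211.02515v1 (2022)
[Zhang2022LandauSiegel], §14 "Mean-value formula II", PDF pp. 76–79 (tex L3822–L3970) — **an
unrefereed manuscript under adjudication**; nothing here asserts or denies its Theorems 1–2, and
nothing here is about Landau–Siegel zeros. Campaign D-0069, discharge lane (layer L3, seat d31).

This file PROVES, unconditionally (no Assumption (A), no FACT-LIST input), five elementary CLAIM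
nodes (and one bookkeeping edge) of the typed §14 (`TypedSection14.lean`, namespace `Typed.Sec14`; the statements are L3-t7's,
cited by name and not restated) — the finite Gauss-sum algebra by which the proof of Proposition
14.1 passes from the characters `ψ (mod p)` to additive characters and back:

| DAG node | decl proved | printed claim | proof |
|---|---|---|---|
| `Z22:§14.u005` | `step14u005_holds : Step14u005` | "For `(mn,p) = 1` we have `Σ_{ψ (mod p)} τ(χψ̄)ψ(m)ψ̄(n) = τ(χ)χ(p)(p−1)e(mD̄n̄/p)`" (p. 76, tex L3862) | CRT factorisation `τ_{Dp}(χψ̄) = τ(χ)τ(ψ̄)χ(p)ψ̄(D)` (`gaussSum_changeLevel_mul_changeLevel`, MV Thm 9.6 = the tree's `PrimitiveQuadratic.gaussSum_eq_mul_of_coprime`) + the twisted orthogonality `Σ_ψ τ(ψ̄)ψ(m)ψ̄(Dn) = φ(p)e(m·(Dn)⁻¹/p)` (the tree's `GaussSums.sum_gaussSum_inv_mul_apply_mul_inv_apply`) |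
| `Z22:§14.u014` | `step14u014_holds : Step14u014` | "`τ(θ_k¹)θ_k¹(p)θ_k¹(−l) = τ(χ)μχ(k)χ(−pl)`" (p. 78, tex L3934) | `τ(θ_k¹) = μ(k)χ(k)τ(χ)` (MV 1975 Lemma 5.2 = the tree's `MontgomeryVaughan1975.gaussSum_changeLevel`), `θ_k¹ = χ` at arguments prime to `Dk` |
| `Z22:§14.u006` (prose) | `step14p77_holds : Step14p77` | "`|τ(χψ_p⁰)| = √D`" (p. 77, tex L3864) | `τ(χψ⁰_p) = μ(p)χ(p)τ(χ)`, `|τ(χ)| = √D` (`LargeSieve.norm_gaussSum_sq`), `p ∤ D` as `p > P ≥ D` for `D ≥ 3` (`lt_of_mem_primeWindow`) |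
| `Z22:§14.u013` (prose) | `step14p78_holds : Step14p78` | "`τ(θ̄) = μ(Dk)` for the principal `θ = ψ⁰_{Dk}`" (p. 78, tex L3928) | Ramanujan's sum `c_N(1) = μ(N)` (the tree's `MontgomeryVaughan1975.gaussSum_one_inv_eq_moebius`) |
| `Z22:§14.u017` (prose) | `step14p79_holds : Step14p79` | "if `θ (mod Dk)` is induced by the primitive `θ* (mod r)` then `r ∣ Dk` and `|τ(θ̄)| ≤ √r`" (p. 79, tex L3950) | Mathlib `conductor_dvd_level`, `changeLevel_primitiveCharacter` + the tree's `norm_gaussSum_changeLevel_inv_le` |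
| `Z22:(14.4)` (EDGE) | `eq144_of_u008_u006b : Step14u008 → Step14u006b → Eq144` | "it follows that … Hence (14.4)" (p. 77, tex L3877–L3882) | termwise in the `l`-series; the silent input `(p, Dk) = 1` for `k ≤ 2P₄` is `exists_two_mul_P4_le_bigP` (`2t₀ ≤ T²` eventually) + `p > P ≥ D` |

The window facts `ForAllLarge` asks for hold from `D ≥ 3` on (`D₀ = 3`): the only use of "`D`
large" is `p > D` for `p ∼ P`, i.e. `D ≤ P = exp{(log D)⁹}`. These are the hypotheses consumed by
the typed deductions `Typed.Sec14.DedEq145` / `DedProp141` (u005 behind (14.3)–(14.4) and u006;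
u014 behind u015; p78 behind u013; p79 behind u017) — an edge is not discharged here, and
Proposition 14.1 itself is NOT asserted.

## References

* Y. Zhang, arXiv:2211.02515v1 (2022), §14 pp. 76–79. [cite: Zhang2022LandauSiegel, §14]
* H. L. Montgomery, R. C. Vaughan, *Multiplicative Number Theory I*, CUP 2007, §9.1 Lemma 9.3,
  §9.2 Theorems 9.5–9.7 ((9.6): `χ(n)τ(χ̄) = Σ_a χ̄(a)e(an/q)`), §9.2 Theorem 9.10 (Gauss sum of an
  induced character). [cite: MontgomeryVaughan2007, §9.1–§9.2]
* H. L. Montgomery, R. C. Vaughan, *The exceptional set in Goldbach's problem*, Acta Arith. 27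
  (1975), §5 Lemmas 5.1–5.2. [cite: MontgomeryVaughanActa1975, §5 Lemmas 5.1–5.2]
-/

noncomputable section

open Complex Real ComplexConjugate

namespace Literature.NumberTheory.LFunctions.Zhang2022.Typed.Sec14

open Skeleton

open scoped ArithmeticFunction.Moebius
open Literature.NumberTheory.LFunctions

/-- `Z22:§14.u013` (prose, p. 78) DISCHARGED: **`τ(ψ̄⁰_N) = μ(N)`** for every modulus `N ≥ 1`
(the Ramanujan sum `c_N(1)`; the tree's `MontgomeryVaughan1975.gaussSum_one_inv_eq_moebius`).
[cite: Zhang2022LandauSiegel, §14 u013 p.78, tex L3928] -/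
theorem step14p78_holds : Step14p78 := by
  intro N hN
  haveI : NeZero N := ⟨hN.ne'⟩
  rw [tauSum_eq_tau, GammaFactor.tau]
  exact Literature.NumberTheory.Sieve.MontgomeryVaughan1975.gaussSum_one_inv_eq_moebius

/-- `Step14p78` — `_holds` alias of `step14p78_holds` above under the fact's exact name (appended
2026-08-28, D-0026 bookkeeping: the proof term is the existing theorem of this file; no statement,
definition or attribute is edited; no new named fact; the ledger's debt table listed the fact
unproved). [cite: Zhang2022LandauSiegel, §14 u013 p.78, tex L3928] -/
theorem _root_.Literature.NumberTheory.LFunctions.Zhang2022.Typed.Sec14.Step14p78_holds :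
    Step14p78 :=
  _root_.Literature.NumberTheory.LFunctions.Zhang2022.Typed.Sec14.step14p78_holds

/-- `Z22:§14.u017` (prose, p. 79) DISCHARGED: **if `θ (mod N)` is induced by the primitive
`θ* (mod r)` then `r ∣ N` and `|τ(θ̄)| ≤ √r`** (`r` = the conductor; Montgomery–Vaughan 1975
Lemma 5.2 in absolute value, the tree's `norm_gaussSum_changeLevel_inv_le`).
[cite: Zhang2022LandauSiegel, §14 u017 p.79, tex L3950] -/
theorem step14p79_holds : Step14p79 := by
  intro N θ hN
  haveI : NeZero N := ⟨hN.ne'⟩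
  refine ⟨θ.conductor_dvd_level, ?_⟩
  haveI : NeZero θ.conductor := ⟨θ.conductor_ne_zero⟩
  rw [tauSum_eq_tau, GammaFactor.tau]
  have key := Literature.NumberTheory.Sieve.MontgomeryVaughan1975.norm_gaussSum_changeLevel_inv_le
    θ.conductor_dvd_level θ.primitiveCharacter_isPrimitive
  rw [DirichletCharacter.changeLevel_primitiveCharacter] at key
  refine key.trans ?_
  split_ifs
  · rw [mul_one]
  · rw [mul_zero]; exact Real.sqrt_nonneg _

/-- `Step14p79` — `_holds` alias of `step14p79_holds` above under the fact's exact name (appended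
2026-08-28, D-0026 bookkeeping: the proof term is the existing theorem of this file; no statement,
definition or attribute is edited; no new named fact; the ledger's debt table listed the fact
unproved). [cite: Zhang2022LandauSiegel, §14 u017 p.79, tex L3950] -/
theorem _root_.Literature.NumberTheory.LFunctions.Zhang2022.Typed.Sec14.Step14p79_holds :
    Step14p79 :=
  _root_.Literature.NumberTheory.LFunctions.Zhang2022.Typed.Sec14.step14p79_holds


/-! ## CRT components of a product character `χ₁ ⊗ χ₂` to the modulus `ab`, `(a,b) = 1` -/

/-- The residues of the CRT lift `e⁻¹(u, v)`: `e⁻¹(u,v) ≡ u (mod a)` and `≡ v (mod b)`. [folklore] -/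
private theorem cast_chineseRemainder_symm {a b : ℕ} (h : a.Coprime b) (u : ZMod a) (v : ZMod b) :
    (ZMod.cast ((ZMod.chineseRemainder h).symm (u, v)) : ZMod a) = u ∧
      (ZMod.cast ((ZMod.chineseRemainder h).symm (u, v)) : ZMod b) = v := by
  have key := PrimitiveQuadratic.chineseRemainder_apply h ((ZMod.chineseRemainder h).symm (u, v))
  rw [RingEquiv.apply_symm_apply] at key
  exact ⟨(congrArg Prod.fst key).symm, (congrArg Prod.snd key).symm⟩

/-- **The CRT components of `χ₁χ₂ (mod ab)`** for `χ₁ (mod a)`, `χ₂ (mod b)`, `(a,b) = 1`, both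
lifted to the modulus `ab`: the first component is `χ₁` and the second is `χ₂`
(Montgomery–Vaughan Lemma 9.3: `χ = χ₁χ₂` with `χ₁(n) = χ(n')`, `n' ≡ n (a)`, `n' ≡ 1 (b)`).
[cite: MontgomeryVaughan2007, Lemma 9.3] -/
theorem crtFst_crtSnd_changeLevel_mul {a b : ℕ} (h : a.Coprime b)
    (χ₁ : DirichletCharacter ℂ a) (χ₂ : DirichletCharacter ℂ b) :
    crtFst h (DirichletCharacter.changeLevel (dvd_mul_right a b) χ₁ *
        DirichletCharacter.changeLevel (dvd_mul_left b a) χ₂) = χ₁ ∧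
      crtSnd h (DirichletCharacter.changeLevel (dvd_mul_right a b) χ₁ *
        DirichletCharacter.changeLevel (dvd_mul_left b a) χ₂) = χ₂ := by
  constructor
  · refine MulChar.ext fun u => ?_
    obtain ⟨x, hx⟩ := isUnit_symm_mk_one h u.isUnit
    obtain ⟨h1, h2⟩ := cast_chineseRemainder_symm h (u : ZMod a) 1
    rw [crtFst_apply, MulChar.mul_apply, ← hx, DirichletCharacter.changeLevel_eq_cast_of_dvd,
      DirichletCharacter.changeLevel_eq_cast_of_dvd, hx, h1, h2, map_one, mul_one]
  · refine MulChar.ext fun v => ?_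
    obtain ⟨x, hx⟩ := isUnit_symm_one_mk h v.isUnit
    obtain ⟨h1, h2⟩ := cast_chineseRemainder_symm h (1 : ZMod a) (v : ZMod b)
    rw [crtSnd_apply, MulChar.mul_apply, ← hx, DirichletCharacter.changeLevel_eq_cast_of_dvd,
      DirichletCharacter.changeLevel_eq_cast_of_dvd, hx, h1, h2, map_one, one_mul]

/-- **Montgomery–Vaughan, Theorem 9.6, for lifted characters**: for `(a,b) = 1`, `χ₁ (mod a)`,
`χ₂ (mod b)`: `τ_{ab}(χ₁χ₂) = τ(χ₁)τ(χ₂)χ₁(b)χ₂(a)` (the tree's `gaussSum_eq_mul_of_coprime` with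
the CRT components identified). [cite: MontgomeryVaughan2007, Theorem 9.6] -/
theorem gaussSum_changeLevel_mul_changeLevel {a b : ℕ} [NeZero a] [NeZero b] (h : a.Coprime b)
    (χ₁ : DirichletCharacter ℂ a) (χ₂ : DirichletCharacter ℂ b) :
    gaussSum (DirichletCharacter.changeLevel (dvd_mul_right a b) χ₁ *
        DirichletCharacter.changeLevel (dvd_mul_left b a) χ₂) (ZMod.stdAddChar (N := a * b)) =
      gaussSum χ₁ (ZMod.stdAddChar (N := a)) * gaussSum χ₂ (ZMod.stdAddChar (N := b)) *
        χ₁ (b : ZMod a) * χ₂ (a : ZMod b) := by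
  obtain ⟨h1, h2⟩ := crtFst_crtSnd_changeLevel_mul h χ₁ χ₂
  rw [PrimitiveQuadratic.gaussSum_eq_mul_of_coprime h, h1, h2]

/-! ## `Z22:§14.u006` prose: `|τ(χψ⁰_p)| = √D` -/

/-- For `D ≥ 3`: `D ≤ P = exp{(log D)⁹}`, hence every `p ∼ P` exceeds `D`. [cite: Zhang2022LandauSiegel, §2 (2.6)] -/
theorem lt_of_mem_primeWindow {D p : ℕ} (hD : 3 ≤ D) (hp : p ∈ primeWindow D) : D < p := by
  have hmem := (Finset.mem_filter.mp hp).1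
  rw [Finset.mem_Ioo] at hmem
  have hP : bigP D < p := (Nat.floor_lt (Real.exp_pos _).le).mp hmem.1
  have hD0 : (0 : ℝ) < D := by exact_mod_cast (show 0 < D by omega)
  have hlog : 1 ≤ Real.log D := by
    rw [Real.le_log_iff_exp_le hD0]
    have : Real.exp 1 < 3 := lt_trans Real.exp_one_lt_d9 (by norm_num)
    exact this.le.trans (by exact_mod_cast hD)
  have hDP : (D : ℝ) ≤ bigP D := by
    rw [bigP, ell]
    calc (D : ℝ) = Real.exp (Real.log D) := (Real.exp_log hD0).symm
      _ ≤ Real.exp (Real.log D ^ 9) := Real.exp_le_exp.mpr (le_self_pow₀ hlog (by norm_num))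
  exact_mod_cast hDP.trans_lt hP

/-- `Z22:§14.u006` (prose, p. 77) DISCHARGED: **`|τ(χψ⁰_p)| = √D`** for the character `χψ⁰_p` to the
modulus `Dp` (`χ` real primitive mod `D`, `ψ⁰_p` principal mod `p`, `p ∼ P`; all `D ≥ 3`): by
`τ(χψ⁰_p) = μ(p)χ(p)τ(χ)` (MV 1975 Lemma 5.2) and `|τ(χ)| = √D`, `p ∤ D`.
[cite: Zhang2022LandauSiegel, §14 u006 p.77, tex L3864] -/
theorem step14p77_holds : Step14p77 := by
  refine ⟨3, fun D _ χ hD _ hprim p hpW => ?_⟩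
  have hp : p.Prime := (Finset.mem_filter.mp hpW).2
  haveI : NeZero p := ⟨hp.ne_zero⟩
  have hDp : D < p := lt_of_mem_primeWindow hD hpW
  have hcop : Nat.Coprime p D :=
    (Nat.Prime.coprime_iff_not_dvd hp).mpr fun h => absurd (Nat.le_of_dvd (by omega) h) (by omega)
  rw [DirichletCharacter.changeLevel_one, mul_one, tauSum_eq_tau, GammaFactor.tau,
    Literature.NumberTheory.Sieve.MontgomeryVaughan1975.gaussSum_changeLevel (dvd_mul_right D p) χ,
    Nat.mul_div_cancel_left p (NeZero.pos D), ArithmeticFunction.moebius_apply_prime hp, norm_mul,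
    norm_mul, ← ZMod.coe_unitOfCoprime p hcop, DirichletCharacter.unit_norm_eq_one, mul_one]
  have hg : ‖gaussSum χ (ZMod.stdAddChar (N := D))‖ = Real.sqrt D := by
    rw [← Literature.NumberTheory.Sieve.LargeSieve.norm_gaussSum_sq hprim, Real.sqrt_sq (norm_nonneg _)]
  rw [hg]
  simp

/-- `Step14p77` — `_holds` alias of `step14p77_holds` above under the fact's exact name (appended
2026-08-28, D-0026 bookkeeping: the proof term is the existing theorem of this file; no statement,
definition or attribute is edited; no new named fact; the ledger's debt table listed the fact
unproved). [cite: Zhang2022LandauSiegel, §14 u006 p.77, tex L3864] -/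
theorem _root_.Literature.NumberTheory.LFunctions.Zhang2022.Typed.Sec14.Step14p77_holds :
    Step14p77 :=
  _root_.Literature.NumberTheory.LFunctions.Zhang2022.Typed.Sec14.step14p77_holds

/-! ## `Z22:§14.u014`: the Gauss sum of the character induced by `χ` to the modulus `Dk` -/

/-- `Z22:§14.u014` DISCHARGED: **`τ(θ_k¹)θ_k¹(p)θ_k¹(−l) = τ(χ)μ(k)χ(k)χ(−pl)`** for `θ_k¹ = χ` induced
to the modulus `Dk`, `(p, Dk) = (l, Dk) = 1` (all `k ≥ 1`; `τ(θ_k¹) = μ(k)χ(k)τ(χ)` by MV 1975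
Lemma 5.2, and `θ_k¹ = χ` at arguments prime to `Dk`). [cite: Zhang2022LandauSiegel, §14 u014 p.78, tex L3934] -/
theorem step14u014_holds : Step14u014 := by
  intro D _ χ _ k p l hk hp hl
  haveI : NeZero k := ⟨hk.ne'⟩
  have hp' : IsCoprime (p : ℤ) ((D * k : ℕ) : ℤ) := Nat.isCoprime_iff_coprime.mpr hp
  have hl' : IsCoprime (-(l : ℤ)) ((D * k : ℕ) : ℤ) := (Nat.isCoprime_iff_coprime.mpr hl).neg_left
  have e1 := DirichletCharacter.changeLevel_eq_cast_of_dvd' χ (dvd_mul_right D k) hp'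
  have e2 := DirichletCharacter.changeLevel_eq_cast_of_dvd' χ (dvd_mul_right D k) hl'
  push_cast at e1 e2
  rw [tauSum_eq_tau, GammaFactor.tau, thetaOne,
    Literature.NumberTheory.Sieve.MontgomeryVaughan1975.gaussSum_changeLevel (dvd_mul_right D k) χ,
    Nat.mul_div_cancel_left k (NeZero.pos D), e1, e2]
  have hneg : (-((p * l : ℕ) : ZMod D)) = (p : ZMod D) * (-(l : ZMod D)) := by push_cast; ring
  rw [hneg, map_mul]
  ring

/-- `Step14u014` — `_holds` alias of `step14u014_holds` above under the fact's exact name (appended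
2026-08-28, D-0026 bookkeeping: the proof term is the existing theorem of this file; no statement,
definition or attribute is edited; no new named fact; the ledger's debt table listed the fact
unproved). [cite: Zhang2022LandauSiegel, §14 u014 p.78, tex L3934] -/
theorem _root_.Literature.NumberTheory.LFunctions.Zhang2022.Typed.Sec14.Step14u014_holds :
    Step14u014 :=
  _root_.Literature.NumberTheory.LFunctions.Zhang2022.Typed.Sec14.step14u014_holds

/-! ## `Z22:§14.u005`: summing `τ(χψ̄)ψ(m)ψ̄(n)` over the characters `ψ (mod p)` -/

/-- `finsetOf` of the set of all characters mod `p` is `Finset.univ`. [folklore] -/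
private theorem finsetOf_univ_char (p : ℕ) [NeZero p] :
    finsetOf (Set.univ : Set (DirichletCharacter ℂ p)) = Finset.univ := by
  classical
  rw [finsetOf, dif_pos Set.finite_univ, Set.Finite.toFinset_univ]

/-- `Z22:§14.u005` DISCHARGED: **`Σ_{ψ (mod p)} τ(χψ̄)ψ(m)ψ̄(n) = τ(χ)χ(p)(p − 1)e(mD̄n̄/p)`** for
`(mn, p) = 1`, `p ∼ P` (all `D ≥ 3`, so `p ∤ D`): by the CRT factorisation
`τ_{Dp}(χψ̄) = τ(χ)τ(ψ̄)χ(p)ψ̄(D)` (MV Thm 9.6) and the twisted orthogonality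
`Σ_ψ τ(ψ̄)ψ(m)ψ̄(Dn) = φ(p)e(m·\overline{Dn}/p)` (MV (9.6) summed over `ψ`).
[cite: Zhang2022LandauSiegel, §14 u005 p.76, tex L3862] -/
theorem step14u005_holds : Step14u005 := by
  refine ⟨3, fun D _ χ hD _ _ p hpW m n hmn => ?_⟩
  have hp : p.Prime := (Finset.mem_filter.mp hpW).2
  haveI : NeZero p := ⟨hp.ne_zero⟩
  haveI : Fact p.Prime := ⟨hp⟩
  have hDp : D < p := lt_of_mem_primeWindow hD hpW
  have hcopD : Nat.Coprime D p :=
    ((Nat.Prime.coprime_iff_not_dvd hp).mpr fun h => absurd (Nat.le_of_dvd (by omega) h) (by omega)).symm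
  have hm : Nat.Coprime m p := Nat.Coprime.coprime_mul_right hmn
  have hn : Nat.Coprime n p := Nat.Coprime.coprime_mul_left hmn
  have hDn : Nat.Coprime (D * n) p := Nat.Coprime.mul_left hcopD hn
  -- the units `m` and `Dn` modulo `p`
  set um : (ZMod p)ˣ := ZMod.unitOfCoprime m hm with hum
  set uk : (ZMod p)ˣ := ZMod.unitOfCoprime (D * n) hDn with huk
  have hum' : (um : ZMod p) = (m : ZMod p) := ZMod.coe_unitOfCoprime m hm
  have huk' : (uk : ZMod p) = ((D * n : ℕ) : ZMod p) := ZMod.coe_unitOfCoprime (D * n) hDn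
  rw [finsetOf_univ_char]
  -- each Gauss sum factors through the CRT
  have hterm : ∀ ψ : DirichletCharacter ℂ p,
      tauSum (D * p) (DirichletCharacter.changeLevel (dvd_mul_right D p) χ *
          DirichletCharacter.changeLevel (dvd_mul_left p D) ψ⁻¹) * ψ (m : ZMod p) * ψ⁻¹ (n : ZMod p) =
        GammaFactor.tau χ * χ (p : ZMod D) *
          (gaussSum ψ⁻¹ (ZMod.stdAddChar (N := p)) * ψ um * ψ⁻¹ uk) := by
    intro ψ
    rw [tauSum_eq_tau, GammaFactor.tau, GammaFactor.tau, gaussSum_changeLevel_mul_changeLevel hcopD,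
      hum', huk', Nat.cast_mul, map_mul]
    ring
  rw [Finset.sum_congr rfl fun ψ _ => hterm ψ, ← Finset.mul_sum,
    Literature.NumberTheory.GaussSums.sum_gaussSum_inv_mul_apply_mul_inv_apply um uk,
    Nat.totient_prime hp]
  -- the additive character value
  have hval : ((uk⁻¹ : (ZMod p)ˣ) : ZMod p) = ((nInv p (D * n) : ℕ) : ZMod p) := by
    rw [nInv, ZMod.natCast_zmod_val, ← huk', ZMod.inv_coe_unit]
  have he : (ZMod.stdAddChar ((um : ZMod p) * ((uk⁻¹ : (ZMod p)ˣ) : ZMod p)) : ℂ) =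
      eAdd ((m : ℝ) * nInv p (D * n) / p) := by
    rw [hum', hval, ← Nat.cast_mul, ZMod.stdAddChar_apply, ZMod.toCircle_natCast, eAdd]
    congr 1
    push_cast
    ring
  rw [he]
  have h1 : (1 : ℕ) ≤ p := hp.one_lt.le
  push_cast [Nat.cast_sub h1]
  ring

/-- `Step14u005` — `_holds` alias of `step14u005_holds` above under the fact's exact name (appended
2026-08-28, D-0026 bookkeeping: the proof term is the existing theorem of this file; no statement,
definition or attribute is edited; no new named fact; the ledger's debt table listed the fact
unproved). [cite: Zhang2022LandauSiegel, §14 u005 p.76, tex L3862] -/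
theorem _root_.Literature.NumberTheory.LFunctions.Zhang2022.Typed.Sec14.Step14u005_holds :
    Step14u005 :=
  _root_.Literature.NumberTheory.LFunctions.Zhang2022.Typed.Sec14.step14u005_holds


/-! ## `Z22:(14.4)`: the edge from u006 (second line) and u008 — "Hence (14.4)" -/

/-- **Eventually `2𝓛⁵¹⁹ ≤ exp{2𝓛^{1.1}}`** (i.e. `2t₀ ≤ T²`): there is `L₀ ≥ 1` with
`2L⁵¹⁹ ≤ exp(2L^{1.1})` for all `L ≥ L₀` (`exp x / x⁵¹⁹ → ∞` and `L ≤ L^{1.1}`).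
[cite: Zhang2022LandauSiegel, §6 p.30 (`T = exp{𝓛^{1.1}}`), §2 (2.8)] -/
theorem exists_two_mul_pow_le_exp :
    ∃ L₀ : ℝ, 1 ≤ L₀ ∧ ∀ L : ℝ, L₀ ≤ L → 2 * L ^ 519 ≤ Real.exp (2 * L ^ (1.1 : ℝ)) := by
  have h := (Real.tendsto_exp_div_pow_atTop 519).eventually_ge_atTop 2
  rw [Filter.eventually_atTop] at h
  obtain ⟨x₀, hx₀⟩ := h
  refine ⟨max x₀ 1, le_max_right _ _, fun L hL => ?_⟩
  have hL1 : 1 ≤ L := le_trans (le_max_right _ _) hL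
  have hL0 : 0 < L := by linarith
  have h1 : 2 ≤ Real.exp L / L ^ 519 := hx₀ L (le_trans (le_max_left _ _) hL)
  have h2 : 2 * L ^ 519 ≤ Real.exp L := by
    rw [le_div_iff₀ (by positivity)] at h1
    linarith
  refine h2.trans (Real.exp_le_exp.mpr ?_)
  have h3 : L ≤ L ^ (1.1 : ℝ) := by
    calc L = L ^ (1 : ℝ) := (Real.rpow_one L).symm
      _ ≤ L ^ (1.1 : ℝ) := Real.rpow_le_rpow_of_exponent_le hL1 (by norm_num)
  linarith

/-- **`2P₄ ≤ P` for all large `D`** (`P₄ = PT⁻²t₀`, so this is `2t₀ ≤ T²`): in particular every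
`k ≤ 2P₄` is `< p` for `p ∼ P`. [cite: Zhang2022LandauSiegel, §6 p.30 (`P₄ = PT⁻²t₀`)] -/
theorem exists_two_mul_P4_le_bigP : ∃ D₁ : ℕ, ∀ D : ℕ, D₁ ≤ D → 2 * P4 D ≤ bigP D := by
  obtain ⟨L₀, hL₀1, hL₀⟩ := exists_two_mul_pow_le_exp
  refine ⟨⌈Real.exp L₀⌉₊, fun D hD => ?_⟩
  have hD1 : (1 : ℝ) ≤ D := by
    have h1 : Real.exp L₀ ≤ D := le_trans (Nat.le_ceil _) (by exact_mod_cast hD)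
    linarith [Real.add_one_le_exp L₀]
  have hD0 : (0 : ℝ) < D := by linarith
  have hL : L₀ ≤ ell D := by
    rw [ell, Real.le_log_iff_exp_le hD0]
    exact le_trans (Nat.le_ceil _) (by exact_mod_cast hD)
  have key := hL₀ (ell D) hL
  have hT2 : bigT D ^ 2 = Real.exp (2 * ell D ^ (1.1 : ℝ)) := by
    rw [bigT, ← Real.exp_nat_mul]; norm_num
  have hTpos : 0 < bigT D ^ 2 := pow_pos (Real.exp_pos _) 2
  have hPpos : 0 < bigP D := Real.exp_pos _
  rw [P4, t0]
  calc 2 * (bigP D / bigT D ^ 2 * ell D ^ 519) = bigP D * (2 * ell D ^ 519) / bigT D ^ 2 := by ring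
    _ ≤ bigP D * bigT D ^ 2 / bigT D ^ 2 := by
        gcongr
        rw [hT2]; exact key
    _ = bigP D := by rw [mul_div_assoc, div_self hTpos.ne', mul_one]

/-- On the window, `p > 2P₄` (indeed `p > P ≥ 2P₄`) once `D` is large: so every `k ∈ [1, 2P₄]` is
prime to `p`. [cite: Zhang2022LandauSiegel, §14 u007 p.77 (`(p, Dk) = 1`)] -/
theorem coprime_of_mem_primeWindow_of_le {D₁ D p k : ℕ} (hD₁ : ∀ D : ℕ, D₁ ≤ D → 2 * P4 D ≤ bigP D)
    (hD : D₁ ≤ D) (hD3 : 3 ≤ D) (hp : p ∈ primeWindow D) (hk : k ∈ Finset.Icc 1 ⌊2 * P4 D⌋₊) :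
    Nat.Coprime p (D * k) := by
  have hprime : p.Prime := (Finset.mem_filter.mp hp).2
  have hPp : bigP D < p := (Nat.floor_lt (Real.exp_pos _).le).mp (Finset.mem_Ioo.mp (Finset.mem_filter.mp hp).1).1
  obtain ⟨hk1, hk2⟩ := Finset.mem_Icc.mp hk
  have hkP : (k : ℝ) ≤ 2 * P4 D := by
    have h0 : 0 ≤ 2 * P4 D := by
      have hell : 0 ≤ ell D := Real.log_natCast_nonneg D
      have : 0 ≤ P4 D := by
        rw [P4, t0]
        exact mul_nonneg (div_nonneg (Real.exp_pos _).le (pow_nonneg (Real.exp_pos _).le 2))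
          (pow_nonneg hell 519)
      linarith
    exact le_trans (by exact_mod_cast hk2) (Nat.floor_le h0)
  have hkp : k < p := by exact_mod_cast (hkP.trans (hD₁ D hD)).trans_lt hPp
  have hDp : D < p := lt_of_mem_primeWindow hD3 hp
  refine Nat.Coprime.mul_right ?_ ?_
  · exact (Nat.Prime.coprime_iff_not_dvd hprime).mpr fun h => absurd (Nat.le_of_dvd (by omega) h) (by omega)
  · exact (Nat.Prime.coprime_iff_not_dvd hprime).mpr fun h => absurd (Nat.le_of_dvd (by omega) h) (by omega)

/-- `Z22:(14.4)` EDGE, kernel-checked: **"it follows that … Hence (14.4)"** (p. 77, tex L3877–L3882) —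
u008 (`Step14u008`: `Δ₁(l/(Dpk))e(lD̄k̄/p) = Δ(l/(Dpk))e(−lp̄/(Dk))` for `(p, Dk) = 1`; PROVED by L3-t7,
`step14u008_holds`) and the second line of u006 (`Step14u006b`, the `Δ₁`-form with `e(lD̄k̄/p)`)
give (14.4) (`Eq144`) with the same constants, termwise inside the `l`-series; the silent input
`(p, Dk) = 1` holds as `k ≤ 2P₄ ≤ P < p` and `p ∤ D` (`coprime_of_mem_primeWindow_of_le`).
[cite: Zhang2022LandauSiegel, §14 (14.4) p.77, tex L3882] -/
theorem eq144_of_u008_u006b (h8 : Step14u008) (h6 : Step14u006b) : Eq144 := by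
  intro B
  obtain ⟨c, hc, C, D₀, hC⟩ := h6 B
  obtain ⟨D₁, hD₁⟩ := exists_two_mul_P4_le_bigP
  refine ⟨c, hc, C, max (max D₀ D₁) 3, fun D _ χ hD hq hprim hA p hpW κs as h141 h142 => ?_⟩
  have hD₀ : D₀ ≤ D := le_trans (le_trans (le_max_left _ _) (le_max_left _ _)) hD
  have hD₁' : D₁ ≤ D := le_trans (le_trans (le_max_right _ _) (le_max_left _ _)) hD
  have hD3 : 3 ≤ D := le_trans (le_max_right _ _) hD
  have hprime : p.Prime := (Finset.mem_filter.mp hpW).2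
  have key := hC D χ hD₀ hq hprim hA p hpW κs as h141 h142
  have hS : ∀ d ∈ Finset.Icc 1 ⌊2 * P4 D⌋₊,
      (d : ℂ)⁻¹ * ∑ k ∈ Finset.Icc 1 ⌊2 * P4 D⌋₊,
          as (d * k) / (k : ℂ) * ∑' l : ℕ, (if Nat.Coprime l k then
            κs (d * l) * Lemma53.Delta1_56 (ell2 D) (t0 D) ((l : ℝ) / ((D : ℝ) * p * k)) *
              eAdd ((l : ℝ) * nInv p (D * k) / p) else 0) =
        (d : ℂ)⁻¹ * ∑ k ∈ Finset.Icc 1 ⌊2 * P4 D⌋₊,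
          as (d * k) / (k : ℂ) * ∑' l : ℕ, (if Nat.Coprime l k then
            κs (d * l) * DeltaW D ((l : ℝ) / ((D : ℝ) * p * k)) *
              eAdd (-((l : ℝ) * nInv (D * k) p / (D * k))) else 0) := by
    intro d _
    congr 1
    refine Finset.sum_congr rfl fun k hk => ?_
    congr 1
    refine tsum_congr fun l => ?_
    split_ifs with hlk
    · have hk0 : 0 < k := (Finset.mem_Icc.mp hk).1
      have hcop : Nat.Coprime p (D * k) := coprime_of_mem_primeWindow_of_le hD₁ hD₁' hD3 hpW hk
      rw [mul_assoc, h8 D k p l (NeZero.pos D) hk0 hprime hcop, ← mul_assoc]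
    · rfl
  rw [Finset.sum_congr rfl hS] at key
  exact key

end Literature.NumberTheory.LFunctions.Zhang2022.Typed.Sec14
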